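import Literature.MathematicalPhysics.QuantumLattice.SchwartzNuclearExpansionBounds
import Literature.MathematicalPhysics.QuantumLattice.SchwartzTensorLineDeriv
import Literature.MathematicalPhysics.QuantumLattice.SchwartzTensorDensityProofs
import HarnessLib

/-!
# Growth of distributions on tensor products: the two-factor lemma

Trunk **T-AQFT** (topic `MathematicalPhysics/QuantumLattice`), families `constructive-qft`,
`crit-ising`; the key step of the discharge of the named fact
`Literature.MathematicalPhysics.QuantumLattice.SchwingerFamily.HasProductGrowth.hasLinearGrowth`
(Osterwalder–Schrader II, Appendix by S. Summers: E0'' implies E0'), completed in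
`SchwingerGrowthProofs`.

**Two-factor lemma** (`twoFactor_bound`). Let `E` be finite-dimensional and `s ∈ ℕ`. There are an
order `t` and a constant `K ≥ 0`, depending only on `E` and `s`, such that for every `j`, every
continuous linear functional `U` on `𝓢(Eʲ⁺¹, ℂ)`, every order `a` and every `A ≥ 0`,

  `‖U(F ⊗ ψ)‖ ≤ A |F|_a |ψ|_s` for all `F ∈ 𝓢(Eʲ, ℂ)`, `ψ ∈ 𝓢(E, ℂ)`
  `⟹ ‖U(G)‖ ≤ A K |G|_{a+t}` for all `G ∈ 𝓢(Eʲ⁺¹, ℂ)`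

(`|·|_m = schwartzNorm m`, `F ⊗ ψ = tensorSnoc F ψ`). The point is that the order in the first
`j` variables enters additively and `K` does not depend on `j, a, U`; iterating it `n` times
(`SchwingerGrowthProofs`) turns the product bound E0'' into the linear bound E0' with
`σₙ' = σₙ Kⁿ` and order `n t`, as in Summers' theorem (where `t = 2r + 7` for `E = ℝ⁴`).

Proof. On a finite sum `G = ∑ᵢ Fᵢ ⊗ ψᵢ` expand each `ψᵢ` by the nuclear expansion of
`SchwartzNuclearExpansion`: `U(G) = lim_R ∑_{β ∈ [-R,R]ᵐ} ∑_k U(G_{β,k} ⊗ e_{β,k})` with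
`G_{β,k} = ∑ᵢ coeff_{β,k}(ψᵢ) Fᵢ`, so that by the hypothesis, the combination bound
`|G_{β,k}|_a ≤ L_{β,k} |G|_{a+t}` (`schwartzNorm_sum_smul_le`) and the summability
`∑ L_{β,k} |e_{β,k}|_s = K < ∞` (`NuclearExpansion.exists_summable_bound`),
`‖U(G)‖ ≤ A K |G|_{a+t}`. Both sides are continuous in `G` and finite sums of tensor products are
dense (`denseSpan_tensorProducts_holds`), whence the claim for all `G`. This replaces the Hermite
expansion `T = ∑ T(H_i) H_i` of Summers' proof, one block of variables at a time.

## Sources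

* K. Osterwalder, R. Schrader, *Axioms for Euclidean Green's functions II*, Comm. Math. Phys.
  42 (1975) 281–305, Appendix (S. Summers), pp. 303–305, (A1)–(A6). [OsterwalderSchraderCMP1975]

## Mathlib and Literature

Used from Mathlib: `Submodule.span_induction`, `ContinuousLinearMap.hasSum` (`HasSum.mapL`),
`Summable.tsum_finsetSum`, `Summable.sum_le_tsum`, `Summable.tsum_prod`, `norm_tsum_le_tsum_norm`,
`le_of_tendsto'`, `isClosed_le`, `closure_minimal`. From the tree: `NuclearExpansion.*`
(`SchwartzNuclearExpansion`, `…Bounds`), `tensorSnoc`, `schwartzNorm_sum_smul_le`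
(`SchwartzTensorLineDeriv`), `denseSpan_tensorProducts_holds` (`SchwartzTensorDensityProofs`).
-/

open scoped SchwartzMap Topology
open Filter Set

noncomputable section

namespace Literature.MathematicalPhysics.QuantumLattice

variable {E : Type*} [NormedAddCommGroup E] [NormedSpace ℝ E]

/-! ### Finite sums of tensor products -/

section Span

variable {j : ℕ}

variable (E j) in
/-- The set of tensor products `F ⊗ ψ`, `F ∈ 𝓢(Eʲ, ℂ)`, `ψ ∈ 𝓢(E, ℂ)`, in the last variable. [folklore] -/
def tensorSnocSet : Set 𝓢((Fin (j + 1) → E), ℂ) :=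
  {T | ∃ (F : 𝓢((Fin j → E), ℂ)) (ψ : 𝓢(E, ℂ)), T = tensorSnoc F ψ}

/-- Elements of the span of the tensor products are finite sums `∑ᵢ Fᵢ ⊗ ψᵢ`. [folklore] -/
theorem exists_repr_of_mem_span {G : 𝓢((Fin (j + 1) → E), ℂ)}
    (hG : G ∈ Submodule.span ℂ (tensorSnocSet E j)) :
    ∃ (n : ℕ) (F : Fin n → 𝓢((Fin j → E), ℂ)) (ψ : Fin n → 𝓢(E, ℂ)),
      G = ∑ i, tensorSnoc (F i) (ψ i) := by
  induction hG using Submodule.span_induction with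
  | mem T hT =>
    obtain ⟨F, ψ, rfl⟩ := hT
    exact ⟨1, fun _ => F, fun _ => ψ, by simp⟩
  | zero => exact ⟨0, Fin.elim0, Fin.elim0, by simp⟩
  | add G₁ G₂ _ _ h₁ h₂ =>
    obtain ⟨n₁, F₁, ψ₁, rfl⟩ := h₁
    obtain ⟨n₂, F₂, ψ₂, rfl⟩ := h₂
    refine ⟨n₁ + n₂, Fin.append F₁ F₂, Fin.append ψ₁ ψ₂, ?_⟩
    rw [Fin.sum_univ_add]
    simp
  | smul c G _ h =>
    obtain ⟨n, F, ψ, rfl⟩ := h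
    refine ⟨n, fun i => c • F i, ψ, ?_⟩
    rw [Finset.smul_sum]
    refine Finset.sum_congr rfl fun i _ => ?_
    rw [← tensorSnocLeft_apply, ← tensorSnocLeft_apply, map_smul]

/-- **Finite sums of tensor products in the last variable are dense** in `𝓢(Eʲ⁺¹, ℂ)` for
finite-dimensional `E`: they contain the full tensor products of real one-point functions
(`denseSpan_tensorProducts_holds`, Reed–Simon I Thm V.13 / OS 1973 §2). [folklore] -/
theorem dense_span_tensorSnocSet [FiniteDimensional ℝ E] (j : ℕ) :
    Dense (Submodule.span ℂ (tensorSnocSet E j) : Set 𝓢((Fin (j + 1) → E), ℂ)) := by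
  have hsub : tensorProducts (E := E) (j + 1) ⊆ tensorSnocSet E j := by
    rintro T ⟨f, hT⟩
    refine ⟨SchwartzMap.tensorFin j fun i => ofRealTest (f i.castSucc), ofRealTest (f (Fin.last j)), ?_⟩
    rw [hT.unique (isTensorOf_tensorFin _), tensorFin_succ_eq_tensorSnoc]
  exact (denseSpan_tensorProducts_holds (E := E) (j + 1)).mono (Submodule.span_mono hsub)

/-- The Schwartz norm of finite order is continuous on `𝓢(X, ℂ)` (a finite supremum of the
defining seminorms). [folklore] -/
theorem continuous_schwartzNorm {X : Type*} [NormedAddCommGroup X] [NormedSpace ℝ X] (M : ℕ) :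
    Continuous fun G : 𝓢(X, ℂ) => schwartzNorm M G :=
  Seminorm.continuous_finsetSup (s := Finset.Iic (M, M)) fun i _ =>
    (schwartz_withSeminorms ℂ X ℂ).continuous_seminorm i

end Span

/-! ### The two-factor lemma -/

section TwoFactor

variable [FiniteDimensional ℝ E]

/-- **Two-factor growth lemma** (the engine of E0'' ⇒ E0', Osterwalder–Schrader II, Appendix):
for every order `s` there are `t` and `K ≥ 0` (depending only on `E, s`) such that for all `j`,
all continuous linear functionals `U` on `𝓢(Eʲ⁺¹, ℂ)`, all orders `a` and all `A ≥ 0`: if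
`‖U(F ⊗ ψ)‖ ≤ A |F|_a |ψ|_s` for all `F, ψ`, then `‖U G‖ ≤ A K |G|_{a+t}` for all `G`. In Summers'
proof this is the passage from (A1) to (A2) for one block of variables, with the Hermite
expansion replaced by the nuclear expansion of `SchwartzNuclearExpansion`. [cite: OsterwalderSchraderCMP1975, Appendix (S. Summers), Theorem E0'' ⇒ E0', pp. 303–305] -/
theorem twoFactor_bound (s : ℕ) :
    ∃ (t : ℕ) (K : ℝ), 0 ≤ K ∧ ∀ (j : ℕ) (U : 𝓢((Fin (j + 1) → E), ℂ) →L[ℂ] ℂ) (a : ℕ) (A : ℝ),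
      0 ≤ A → (∀ (F : 𝓢((Fin j → E), ℂ)) (ψ : 𝓢(E, ℂ)),
        ‖U (tensorSnoc F ψ)‖ ≤ A * schwartzNorm a F * schwartzNorm s ψ) →
      ∀ G : 𝓢((Fin (j + 1) → E), ℂ), ‖U G‖ ≤ A * K * schwartzNorm (a + t) G := by
  -- coordinates and the nuclear expansion of `𝓢(E, ℂ)`
  set m : ℕ := Module.finrank ℝ E with hm
  have hfin : Module.finrank ℝ E = Module.finrank ℝ (EuclideanSpace ℝ (Fin m)) := by simp [hm]
  let Λ : E ≃L[ℝ] EuclideanSpace ℝ (Fin m) := ContinuousLinearEquiv.ofFinrankEq hfin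
  obtain ⟨t, L, hL0, hcoeff, hsum⟩ := NuclearExpansion.exists_summable_bound Λ s
  set w : (Fin m → ℤ) × (Fin m → ℤ) → ℝ := fun p =>
    L p.1 p.2 * schwartzNorm s (NuclearExpansion.e Λ p.1 p.2) with hw
  have hw0 : ∀ p, 0 ≤ w p := fun p => mul_nonneg (hL0 _ _) (schwartzNorm_nonneg _ _)
  set K : ℝ := ∑' p, w p with hK
  have hK0 : 0 ≤ K := tsum_nonneg hw0
  have hKeq : ∑' β, ∑' k, w (β, k) = K := (hsum.tsum_prod).symm
  refine ⟨t, K, hK0, fun j U a A hA hU G => ?_⟩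
  -- Step 1: finite sums of tensor products
  have hfinite : ∀ (n : ℕ) (F : Fin n → 𝓢((Fin j → E), ℂ)) (ψ : Fin n → 𝓢(E, ℂ)),
      ‖U (∑ i, tensorSnoc (F i) (ψ i))‖ ≤
        A * K * schwartzNorm (a + t) (∑ i, tensorSnoc (F i) (ψ i)) := by
    intro n F ψ
    set G₀ : 𝓢((Fin (j + 1) → E), ℂ) := ∑ i, tensorSnoc (F i) (ψ i) with hG₀
    set B : ℝ := schwartzNorm (a + t) G₀ with hB
    have hB0 : 0 ≤ B := schwartzNorm_nonneg _ _
    -- the functionals `ψ ↦ U(Fᵢ ⊗ ψ)`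
    let UF : Fin n → (𝓢(E, ℂ) →L[ℂ] ℂ) := fun i => U.comp (tensorSnocRight (F i))
    have hUF : ∀ i φ, UF i φ = U (tensorSnoc (F i) φ) := fun i φ => by
      simp [UF]
    -- the terms of the double series and their size
    let term : (Fin m → ℤ) → (Fin m → ℤ) → ℂ := fun β k =>
      U (tensorSnoc (∑ i, NuclearExpansion.coeff Λ β k (ψ i) • F i) (NuclearExpansion.e Λ β k))
    have hterm : ∀ β k, ‖term β k‖ ≤ A * B * w (β, k) := by
      intro β k
      have hcomb : schwartzNorm a (∑ i, NuclearExpansion.coeff Λ β k (ψ i) • F i) ≤ L β k * B :=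
        schwartzNorm_sum_smul_le Finset.univ F ψ (NuclearExpansion.coeff Λ β k) (hL0 β k)
          (hcoeff β k) a
      calc ‖term β k‖ ≤ A * schwartzNorm a (∑ i, NuclearExpansion.coeff Λ β k (ψ i) • F i) *
            schwartzNorm s (NuclearExpansion.e Λ β k) := hU _ _
        _ ≤ A * (L β k * B) * schwartzNorm s (NuclearExpansion.e Λ β k) :=
            mul_le_mul_of_nonneg_right (mul_le_mul_of_nonneg_left hcomb hA) (schwartzNorm_nonneg _ _)
        _ = A * B * w (β, k) := by rw [hw]; ring
    have hsumk : ∀ β, Summable fun k => w (β, k) := fun β => hsum.prod_factor β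
    have hsum_term : ∀ β, Summable fun k => ‖term β k‖ := fun β =>
      Summable.of_nonneg_of_le (fun k => norm_nonneg _) (hterm β) ((hsumk β).mul_left (A * B))
    -- the expansion of each localised piece, mapped through `U`
    have hpiece : ∀ β, ∑ i, UF i (NuclearExpansion.eta Λ β (ψ i)) = ∑' k, term β k := by
      intro β
      have hi : ∀ i, HasSum (fun k => NuclearExpansion.coeff Λ β k (ψ i) * UF i (NuclearExpansion.e Λ β k))
          (UF i (NuclearExpansion.eta Λ β (ψ i))) := by
        intro i
        have h := (NuclearExpansion.hasSum_coeff_smul_e Λ β (ψ i)).mapL (UF i)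
        simpa only [map_smul, smul_eq_mul] using h
      calc ∑ i, UF i (NuclearExpansion.eta Λ β (ψ i))
          = ∑ i, ∑' k, NuclearExpansion.coeff Λ β k (ψ i) * UF i (NuclearExpansion.e Λ β k) :=
            Finset.sum_congr rfl fun i _ => (hi i).tsum_eq.symm
        _ = ∑' k, ∑ i, NuclearExpansion.coeff Λ β k (ψ i) * UF i (NuclearExpansion.e Λ β k) :=
            (Summable.tsum_finsetSum fun i _ => (hi i).summable).symm
        _ = ∑' k, term β k := by
            refine tsum_congr fun k => ?_
            simp only [term, hUF, tensorSnoc_sum_smul, map_sum, map_smul, smul_eq_mul]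
    -- the partial sums over cubes converge to `U G₀`
    let T : ℕ → ℂ := fun R => ∑ i, UF i (∑ β ∈ latticeCube m R, NuclearExpansion.eta Λ β (ψ i))
    have hT : Tendsto T atTop (𝓝 (U G₀)) := by
      have h1 : U G₀ = ∑ i, UF i (ψ i) := by
        rw [hG₀, map_sum]
        exact Finset.sum_congr rfl fun i _ => (hUF i (ψ i)).symm
      rw [h1]
      exact tendsto_finsetSum _ fun i _ =>
        ((UF i).continuous.tendsto _).comp (NuclearExpansion.tendsto_sum_eta Λ (ψ i))
    -- and are bounded by `A K B`
    have hTR : ∀ R, ‖T R‖ ≤ A * K * B := by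
      intro R
      have hTeq : T R = ∑ β ∈ latticeCube m R, ∑' k, term β k := by
        simp only [T, map_sum]
        rw [Finset.sum_comm]
        exact Finset.sum_congr rfl fun β _ => hpiece β
      rw [hTeq]
      calc ‖∑ β ∈ latticeCube m R, ∑' k, term β k‖
          ≤ ∑ β ∈ latticeCube m R, ‖∑' k, term β k‖ := norm_sum_le _ _
        _ ≤ ∑ β ∈ latticeCube m R, ∑' k, ‖term β k‖ :=
            Finset.sum_le_sum fun β _ => norm_tsum_le_tsum_norm (hsum_term β)
        _ ≤ ∑ β ∈ latticeCube m R, ∑' k, A * B * w (β, k) :=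
            Finset.sum_le_sum fun β _ =>
              (hsum_term β).tsum_le_tsum (hterm β) ((hsumk β).mul_left (A * B))
        _ = A * B * ∑ β ∈ latticeCube m R, ∑' k, w (β, k) := by
            rw [Finset.mul_sum]
            exact Finset.sum_congr rfl fun β _ => (hsumk β).tsum_mul_left _
        _ ≤ A * B * ∑' β, ∑' k, w (β, k) := by
            gcongr
            exact hsum.prod.sum_le_tsum _ fun β _ => tsum_nonneg fun k => hw0 (β, k)
        _ = A * K * B := by rw [hKeq]; ring
    exact le_of_tendsto' hT.norm hTR
  -- Step 2: density
  have hclosed : IsClosed {G : 𝓢((Fin (j + 1) → E), ℂ) | ‖U G‖ ≤ A * K * schwartzNorm (a + t) G} :=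
    isClosed_le (continuous_norm.comp U.continuous) (continuous_const.mul (continuous_schwartzNorm _))
  have hspan : (Submodule.span ℂ (tensorSnocSet E j) : Set 𝓢((Fin (j + 1) → E), ℂ)) ⊆
      {G | ‖U G‖ ≤ A * K * schwartzNorm (a + t) G} := by
    intro G hG
    obtain ⟨n, F, ψ, rfl⟩ := exists_repr_of_mem_span hG
    exact hfinite n F ψ
  have hG : G ∈ closure (Submodule.span ℂ (tensorSnocSet E j) : Set 𝓢((Fin (j + 1) → E), ℂ)) := by
    rw [(dense_span_tensorSnocSet j).closure_eq]
    exact Set.mem_univ G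
  exact closure_minimal hspan hclosed hG

end TwoFactor

end Literature.MathematicalPhysics.QuantumLattice
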